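import Mathlib
import Literature.Computability.AlgebraicComplexity.GrenetProjection
import Summits.ValiantsHypothesis.ValiantsHypothesis.Theses.ProjectionRigidity

/-!
# Route `ProjectionRigidity`: Grenet's projection bound and the exact content of `ProjLaplaceDoubling`

Helper file for crux stmt-ValiantsHypothesis-16002 (`ProjLaplaceDoubling`), line lead 2026-08-17.

* `detProjectionComplexity_perPoly_eq_of_opt` — by Grenet's projection bound
  (`Literature…detProjectionComplexity_perPoly_le_grenet`, Grenet 2011 Thm. 1 in Valiant's model; the
  route's support item `GrenetProjection` is linked separately as `GrenetProjection_holds`) the crux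
  hypothesis `2ⁿ − 1 ≤ pdc(per_n)` PINS `pdc(per_n) = 2ⁿ − 1`: Grenet is then optimal, of size exactly the
  core size `N` every window / packing statement speaks about.
* `projOptimalUniqueThree_of_projOptimalUnique` — with `pdc(per₃) = 7` (tree:
  `detProjectionComplexity_perPoly_three`, ABV 2017 Cor. 1.4 + Grenet) the level-3 instance of the crux's
  antecedent `ProjOptimalUnique` is literally the support item `ProjOptimalUniqueThree` (stmt-16004): a
  second `GL₇(ℂ)² × G_per × ᵀ` orbit of `7 × 7` complex projections of `per₃` refutes `ProjOptimalUnique`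
  and thereby proves `ProjLaplaceDoubling` vacuously (`projLaplaceDoubling_of_not_projOptimalUniqueThree`).
* `projLaplaceDoubling_iff` — the crux is EXACTLY `ProjOptimalUnique → Target` (the refuter's probe
  `iff_unique_imp_target`, now in the tree): forward by `Nat.le_induction` from the anchor
  `7 ≤ dc(per₃) ≤ pdc(per₃)`, backward trivially.  So the crux is unfalsifiable without a proof of
  `ProjOptimalUnique`, and any proof either refutes `ProjOptimalUnique` or proves `Target` from it.

The registered line `birth` (window reduction ∘ core packing) is dead: its stub
`stub_windowReduction` is false at `n = 3` (purified Koszul twists of Grenet₃ of sizes 10–14 admit no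
constant-gauge window with a projection core; `Cruxes/ProjLaplaceDoubling/Lines/birth-dead.md`).
-/

-- single-conjunct layout: Sub = Summit, duplicated namespace component intended
set_option linter.dupNamespace false

namespace Summit.ValiantsHypothesis.ValiantsHypothesis.Theorems

open Literature.Computability.AlgebraicComplexity
open Summit.ValiantsHypothesis.ValiantsHypothesis.Theses.ProjectionRigidity

/-- Under the crux hypothesis `2ⁿ − 1 ≤ pdc(per_n)` (`n ≥ 1`) Valiant's measure is pinned:
`pdc(per_n) = 2ⁿ − 1` — Grenet's projection is then optimal, of size exactly the core size `N` that
every window / packing statement of the route speaks about. [folklore] -/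
theorem detProjectionComplexity_perPoly_eq_of_opt {n : ℕ} (hn : 1 ≤ n)
    (h : 2 ^ n - 1 ≤ detProjectionComplexity (perPoly (Fin n) ℂ)) :
    detProjectionComplexity (perPoly (Fin n) ℂ) = 2 ^ n - 1 :=
  detProjectionComplexity_perPoly_eq_of_le ℂ (by omega) h

/-- **The level-3 instance of `ProjOptimalUnique` is `ProjOptimalUniqueThree`** (transport along
`pdc(per₃) = 7`, tree `detProjectionComplexity_perPoly_three`): refuting the support item stmt-16004
refutes the crux's antecedent stmt-16001. [folklore] -/
theorem projOptimalUniqueThree_of_projOptimalUnique :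
    ProjOptimalUnique → ProjOptimalUniqueThree := by
  intro hU
  have h3 := hU 3 le_rfl
  rw [detProjectionComplexity_perPoly_three] at h3
  exact h3

/-- Hence a second orbit of optimal `7 × 7` complex projections of `per₃` would prove the crux
`ProjLaplaceDoubling` VACUOUSLY (its antecedent `ProjOptimalUnique` would be false). [folklore] -/
theorem projLaplaceDoubling_of_not_projOptimalUniqueThree :
    ¬ ProjOptimalUniqueThree → ProjLaplaceDoubling :=
  fun h hU => absurd (projOptimalUniqueThree_of_projOptimalUnique hU) h

/-- **The exact content of the crux**: `ProjLaplaceDoubling ↔ (ProjOptimalUnique → Target)`.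
Forward: `Nat.le_induction` from the anchor `2³ − 1 = 7 ≤ dc(per₃) ≤ pdc(per₃)` (Alper–Bogart–Velasco
2017 Cor. 1.4, tree `seven_le_determinantalComplexity_perPoly_three`, and `dc ≤ pdc`); backward: the
doubling step's conclusion is an instance of `Target`.  (The refuter's probe `iff_unique_imp_target`,
stmt-16002 evidence `Probe.lean`, made permanent.) [folklore] -/
theorem projLaplaceDoubling_iff : ProjLaplaceDoubling ↔ (ProjOptimalUnique → Target) := by
  constructor
  · intro hD hU n hn
    induction n, hn using Nat.le_induction with
    | base =>
      exact seven_le_determinantalComplexity_perPoly_three.trans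
        (determinantalComplexity_le_detProjectionComplexity_holds _)
    | succ n hn ih => exact hD hU n hn ih
  · intro hT hU n _ _
    exact hT hU (n + 1) (by omega)

/-- The first open instance, isolated: at `n = 3` the crux's conclusion is exactly the support item
`PdcPerFour` direction `15 ≤ pdc(per₄)` (stmt-16005); given that value the level-3 doubling holds with
no uniqueness at all. [folklore] -/
theorem fifteen_le_detProjectionComplexity_perPoly_four_of_pdcPerFour (h4 : PdcPerFour) :
    2 ^ (3 + 1) - 1 ≤ detProjectionComplexity (perPoly (Fin (3 + 1)) ℂ) := by
  have h : detProjectionComplexity (perPoly (Fin 4) ℂ) = 15 := h4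
  show 2 ^ (3 + 1) - 1 ≤ detProjectionComplexity (perPoly (Fin 4) ℂ)
  omega

end Summit.ValiantsHypothesis.ValiantsHypothesis.Theorems
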